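import Summits.BirchSwinnertonDyer.BirchSwinnertonDyer.Theorems.ThetaPartnerAtTwoSignedTransportAtTwoLocalFactorStructure
import Summits.BirchSwinnertonDyer.Rank1Residual.X2.LocalInertiaCohomologyAdditive
import Summits.BirchSwinnertonDyer.Rank1Residual.X2.GreenbergVatsalUnramifiedAway
import Literature.NumberTheory.GaloisRepresentations.DecompositionGroupRelSlim
import Literature.NumberTheory.GaloisRepresentations.LocalGaloisGroupFrobeniusProofs
import HarnessLib

/-!
# The local factor `Y_v = im(H¹(H ∩ D_v, E[p^∞]) → H¹(H ∩ I_v, E[p^∞]))` of the cyclotomic `ℤ_p`-tower IS the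
# eventually-Frobenius-fixed part of `H¹(I_{K_v}, E[p^∞])` (transport `Γ_{K_v} ≅ D_v` + the abstract structure theorem;
# GV 2000 Prop. (2.4) READ AT any `p`, structure half; line `bridge`, crux `SignedTransportAtTwo`, stmt-BirchSwinnertonDyer-20333,
# route `ThetaPartnerAtTwo`; lead prover bsd-wall-tp2-p1 g7; `--supports`, route-independent, closes nothing)

HONEST FRAMING. THEOREMS ONLY; no definition; BSD is not proved by any of this. For a number field `K`, a prime `p`, the
CYCLOTOMIC `ℤ_p`-extension `κ` (`H = ker κ = Gal(K̄/K_∞)`), a finite place `v ∤ p`, an elliptic curve `E/K` and the local field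
`F = K_v` with a Frobenius lift `φ ∈ Γ_F` (`IsFrobPow φ 1`): writing `ρ_F` for `E[p^∞]` restricted to `Γ_F` along the chosen
embedding (`absGaloisRestrict K F`, injective with image `D_v`, carrying `absInertia F` onto `I_v ≤ H`), there is an additive
BIJECTION `α : H¹(H ∩ I_v, E[p^∞]) → H¹(I_F, ρ_F)` (inflation along `I_F ≅ H ∩ I_v`) under which the tree's local factor
`Y_v = range (resH1Hom (subgroupInclusion (inertiaIn_le_decompIn H v)) id)` (the `v`-component of the detecting map of the
imprimitive Selmer groups, files `LocalEmbedding` / `LocalProductCount`) corresponds to the classes fixed by `φ^{p^n}` for some `n`: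

* `map_one_surjective_of_inverse` — inflation along a continuous isomorphism of topological groups is onto on `H¹`;
* **`exists_bijective_localFactor_iff_eventually_fixed`** — `∃ α` bijective additive with
  `y ∈ Y_v ↔ ∃ n, φ^{p^n}·(α y) = α y`.

Method: `Γ_F ≅ D_v` (`absGaloisRestrict_adicCompletion_injective`) restricts to `I_F ≅ H ∩ I_v` (`I_v ≤ H`:
`inertia_le_kerSubgroup_of_isCyclotomic`) and to `ker(κ ∘ res) ≅ H ∩ D_v`; inflation along these is injective
(`map_one_injective_of_surjective`) and surjective (§1), and intertwines the two restriction maps; then the landed abstract theorem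
`exists_resLe_ker_eq_iff_exists_conjMap_pow_eq` applies (`Γ_F ⧸ I_F` free procyclic generated by `φ̄`:
`isFreeProcyclic_quotient_absInertia'`, `dense_zpowers_mk_absInertia_of_isFrobPow`; `κ(res φ) ≠ 1` because `D_v ≰ H`,
`not_decomp_le_kerSubgroup_of_isCyclotomic`, and `Γ_F = cl(I_F·⟨φ⟩)`; `E[p^∞]` is `p`-primary with finite `p^k`-torsion).

References: [GreenbergVatsal2000] §2 pp. 16–17, 20–22, Prop. (2.4); [NeukirchSchmidtWingberg2008] (1.6.7), (7.5.3);
[Rubin2000] Lemma 1.3.2.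
-/

set_option autoImplicit false
-- D-0017: single-problem summit, so `Summit.BirchSwinnertonDyer.BirchSwinnertonDyer.…` repeats a namespace BY DESIGN.
set_option linter.dupNamespace false

noncomputable section

open scoped Classical Pointwise
open CategoryTheory Function Topology
open _root_.Subgroup
open NumberField IsDedekindDomain Field
open Literature.NumberTheory.GaloisRepresentations Literature.AnabelianGeometry.AbsoluteAnabelian Literature.GroupTheory
open Literature.NumberTheory.EllipticCurves Literature.NumberTheory.EllipticCurves.GreenbergSelmer
open Summit.BirchSwinnertonDyer.Rank1Residual.X11b.LocBridge Summit.BirchSwinnertonDyer.Rank1Residual.X2.GreenbergVatsalUnramifiedAway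

namespace Summit.BirchSwinnertonDyer.BirchSwinnertonDyer.Theorems.SignedTransportAtTwo

universe u v

/-! ## §1. Inflation along an isomorphism of topological groups is onto on `H¹` -/

section Generic

variable {R : Type u} [CommRing R] [TopologicalSpace R]
variable {G' G'' : Type v} [Group G'] [TopologicalSpace G'] [IsTopologicalGroup G'] [Group G''] [TopologicalSpace G'']
  [IsTopologicalGroup G'']

/-- **Inflation along a continuous isomorphism is surjective on `H¹`**: if `θ : G' → G''` is a continuous homomorphism with a
continuous two-sided inverse `s`, every class of `H¹(G', res_θ X)` is `[f ∘ θ]` for the continuous cocycle `f ∘ s` of `G''`.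
[cite: SerreGaloisCohomology1997, I §2.4] -/
theorem map_one_surjective_of_inverse (X : TopRep.{v} R G'') (θ : G' →ₜ* G'') (s : G'' → G') (hs : Continuous s)
    (hθs : ∀ y, θ (s y) = y) (hsθ : ∀ x, s (θ x) = x) :
    Surjective (ContinuousCohomology.map θ (𝟙 (TopRep.res (θ : G' →* G'') X)) 1) := by
  intro c
  obtain ⟨f, rfl⟩ := oneCocycleClass_surjective _ c
  have hsmul : ∀ y₁ y₂, s (y₁ * y₂) = s y₁ * s y₂ := fun y₁ y₂ => by
    have hinj : Injective θ := fun a b hab => by rw [← hsθ a, ← hsθ b, hab]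
    apply hinj
    rw [map_mul, hθs, hθs, hθs]
  let f'' : contOneCocycles X :=
    ⟨f.1.comp ⟨s, hs⟩, fun y₁ y₂ => by
      change f.1 (s (y₁ * y₂)) = f.1 (s y₁) + X.ρ y₁ (f.1 (s y₂))
      rw [hsmul, f.2 (s y₁) (s y₂)]
      congr 1
      change X.ρ (θ (s y₁)) _ = _
      rw [hθs]⟩
  refine ⟨oneCocycleClass X f'', ?_⟩
  rw [map_oneCocycleClass]
  refine congrArg _ (Subtype.ext (ContinuousMap.ext fun x => ?_))
  change f.1 (s (θ x)) = f.1 x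
  rw [hsθ]

end Generic

/-! ## §2. The local factor of the cyclotomic tower and the local field `K_v` -/

section NumberField

variable {K : Type} [Field K] [NumberField K] {p : ℕ} [Fact p.Prime] (κ : ZpExtension K p)
  (v : HeightOneSpectrum (𝓞 K)) (W : WeierstrassCurve K) [W.IsElliptic]

/-- **The local factor is the eventually-Frobenius-fixed part of `H¹(I_{K_v}, E[p^∞])`.** For the cyclotomic `ℤ_p`-extension
`κ` (`H = ker κ`), a finite place `v ∤ p`, an elliptic curve `E/K` and a Frobenius lift `φ ∈ Γ_{K_v}`: there is an additive
bijection `α : H¹(H ∩ I_v, E[p^∞]) → H¹(I_{K_v}, E[p^∞]|_{Γ_{K_v}})` (inflation along `I_{K_v} ≅ H ∩ I_v`) such that a class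
lies in `Y_v = im(H¹(H ∩ D_v, E[p^∞]) → H¹(H ∩ I_v, E[p^∞]))` iff its image is fixed by `φ^{p^n}` for some `n` — GV's
`𝓗_η = H¹(K_{∞,η}, E[p^∞]) ↪ H¹(I_η, E[p^∞])` at one place `η ∣ v` of `K_∞`, identified with the union over the layers
`K_{n,η}` of the Frobenius-invariant inertia classes. [cite: GreenbergVatsal2000, §2 pp. 16–17, 20–22, Prop. (2.4)]
[cite: NeukirchSchmidtWingberg2008, (1.6.7)] -/
theorem exists_bijective_localFactor_iff_eventually_fixed (hκ : κ.IsCyclotomic) (hpv : ((p : ℕ) : 𝓞 K) ∉ v.asIdeal)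
    {φ : absoluteGaloisGroup (v.adicCompletion K)} (hφ : IsFrobPow φ 1) :
    ∃ α : discreteH1 (inertiaIn κ.kerSubgroup v) (W.geomPrimaryTorsion p) →+
        continuousCohomology 1 (subgroupRep
          (((primaryGaloisModule W p).restrict (absGaloisRestrict K (v.adicCompletion K))).toTopRep)
          (absInertia (v.adicCompletion K))),
      Bijective α ∧
      ∀ y : discreteH1 (inertiaIn κ.kerSubgroup v) (W.geomPrimaryTorsion p),
        y ∈ (resH1Hom (subgroupInclusion (inertiaIn_le_decompIn κ.kerSubgroup v))
              (AddMonoidHom.id (W.geomPrimaryTorsion p)) (fun _ _ ↦ rfl)).range ↔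
          ∃ n : ℕ, haveI : (absInertia (v.adicCompletion K)).Normal := absInertia_normal_holds (v.adicCompletion K)
            conjMap (((primaryGaloisModule W p).restrict (absGaloisRestrict K (v.adicCompletion K))).toTopRep)
              (absInertia (v.adicCompletion K)) (φ ^ p ^ n) 1 (α y) = α y := by
  -- notation
  let F := v.adicCompletion K
  haveI : CompactSpace (absoluteGaloisGroup F) := absoluteGaloisGroup_compactSpace F
  haveI hInormal : (absInertia F).Normal := absInertia_normal_holds F
  let res : absoluteGaloisGroup F →ₜ* absoluteGaloisGroup K := absGaloisRestrict K F
  have hinj : Injective res := absGaloisRestrict_adicCompletion_injective K v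
  let H : Subgroup (absoluteGaloisGroup K) := κ.kerSubgroup
  let A := W.geomPrimaryTorsion p
  let ρ : ContinuousRep (absoluteGaloisGroup F) ℤ A := (primaryGaloisModule W p).restrict res
  have hIH : inertia v ≤ H := inertia_le_kerSubgroup_of_isCyclotomic κ v hκ hpv
  -- the local character `κ_F = κ ∘ res` and its kernel `P_F`
  let κF : absoluteGaloisGroup F →ₜ* Multiplicative ℤ_[p] := κ.toContinuousMonoidHom.comp res
  have hκFI : ∀ i ∈ absInertia F, κF i = 1 := fun i hi =>
    ZpExtension.mem_kerSubgroup.mp (hIH (Subgroup.mem_map_of_mem _ hi))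
  have hIP : absInertia F ≤ κF.toMonoidHom.ker := fun i hi => hκFI i hi
  -- `θ_I : absInertia F → H ∩ I_v` and `θ_D : P_F → H ∩ D_v`, bijective
  let θI : absInertia F →ₜ* inertiaIn H v :=
    { toFun := fun σ ↦ ⟨⟨res σ, ⟨σ, rfl⟩⟩,
        (mem_inertiaIn_iff H v _).2 ⟨hIH (Subgroup.mem_map_of_mem _ σ.2), Subgroup.mem_map_of_mem _ σ.2⟩⟩
      map_one' := Subtype.ext (Subtype.ext (by simp))
      map_mul' := fun x y ↦ Subtype.ext (Subtype.ext (by simp))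
      continuous_toFun := by
        refine Continuous.subtype_mk (Continuous.subtype_mk ?_ _) _
        exact res.continuous_toFun.comp continuous_subtype_val }
  have hθI_coe : ∀ σ : absInertia F, (((θI σ : inertiaIn H v) : decomp v) : absoluteGaloisGroup K) = res σ := fun _ => rfl
  have hθIsurj : Surjective θI := by
    intro x
    obtain ⟨σ, hσ, hσx⟩ := Subgroup.mem_map.1 ((mem_inertiaIn_iff H v x.1).1 x.2).2
    exact ⟨⟨σ, hσ⟩, Subtype.ext (Subtype.ext hσx)⟩
  have hθIinj : Injective θI := fun a b hab => by
    apply Subtype.ext; apply hinj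
    have := congrArg (fun z : inertiaIn H v => ((z : decomp v) : absoluteGaloisGroup K)) hab
    exact this
  let θD : κF.toMonoidHom.ker →ₜ* decompIn H v :=
    { toFun := fun σ ↦ ⟨⟨res σ, ⟨σ, rfl⟩⟩, (mem_decompIn_iff H v _).2 (by
        have h1 : κF σ = 1 := σ.2
        exact ZpExtension.mem_kerSubgroup.mpr h1)⟩
      map_one' := Subtype.ext (Subtype.ext (by
        change res ((1 : κF.toMonoidHom.ker) : absoluteGaloisGroup F) = 1
        rw [OneMemClass.coe_one, map_one]))
      map_mul' := fun x y ↦ Subtype.ext (Subtype.ext (by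
        change res ((x * y : κF.toMonoidHom.ker) : absoluteGaloisGroup F) = res x * res y
        rw [Subgroup.coe_mul, map_mul]))
      continuous_toFun := by
        refine Continuous.subtype_mk (Continuous.subtype_mk ?_ _) _
        exact res.continuous_toFun.comp continuous_subtype_val }
  have hθDsurj : Surjective θD := by
    intro x
    obtain ⟨σ, hσx⟩ := (mem_decomp_iff v _).1 x.1.2
    have hσP : σ ∈ κF.toMonoidHom.ker := by
      have hxH := (mem_decompIn_iff H v x.1).1 x.2
      rw [← hσx] at hxH
      exact ZpExtension.mem_kerSubgroup.mp hxH
    exact ⟨⟨σ, hσP⟩, Subtype.ext (Subtype.ext hσx)⟩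
  have hθDinj : Injective θD := fun a b hab => by
    apply Subtype.ext; apply hinj
    have := congrArg (fun z : decompIn H v => ((z : decomp v) : absoluteGaloisGroup K)) hab
    exact this
  -- continuous inverses (compact to Hausdorff)
  haveI : CompactSpace (absInertia F) :=
    isCompact_iff_compactSpace.mp (isClosed_absInertia_holds F).isCompact
  have hPc : IsClosed ((κF.toMonoidHom.ker : Subgroup (absoluteGaloisGroup F)) : Set (absoluteGaloisGroup F)) := by
    have : ((κF.toMonoidHom.ker : Subgroup (absoluteGaloisGroup F)) : Set (absoluteGaloisGroup F)) = κF ⁻¹' {1} := by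
      ext σ; rfl
    rw [this]
    exact (isClosed_singleton).preimage κF.continuous_toFun
  haveI : CompactSpace (κF.toMonoidHom.ker : Subgroup (absoluteGaloisGroup F)) :=
    isCompact_iff_compactSpace.mp hPc.isCompact
  let eI : absInertia F ≃ inertiaIn H v := Equiv.ofBijective θI ⟨hθIinj, hθIsurj⟩
  have heIc : Continuous eI.symm := Continuous.continuous_symm_of_equiv_compact_to_t2 (f := eI) θI.continuous_toFun
  let eD : (κF.toMonoidHom.ker : Subgroup (absoluteGaloisGroup F)) ≃ decompIn H v := Equiv.ofBijective θD ⟨hθDinj, hθDsurj⟩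
  have heDc : Continuous eD.symm := Continuous.continuous_symm_of_equiv_compact_to_t2 (f := eD) θD.continuous_toFun
  -- the inflation maps `α_I`, `α_D` (injective and surjective)
  let αI := ContinuousCohomology.map θI (𝟙 (TopRep.res (θI : absInertia F →* inertiaIn H v)
    (discreteTopRep (inertiaIn H v) A))) 1
  let XD : TopRep ℤ (decompIn H v) := discreteTopRep (decompIn H v) A
  let αD := ContinuousCohomology.map θD (𝟙 (TopRep.res
    (θD : (κF.toMonoidHom.ker : Subgroup (absoluteGaloisGroup F)) →* decompIn H v) XD)) 1
  have hαIinj : Injective αI := map_one_injective_of_surjective _ θI hθIsurj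
  have hαIsurj : Surjective αI :=
    map_one_surjective_of_inverse _ θI eI.symm heIc (fun y => eI.apply_symm_apply y) (fun x => eI.symm_apply_apply x)
  have hαDsurj : Surjective αD :=
    map_one_surjective_of_inverse _ θD eD.symm heDc (fun y => eD.apply_symm_apply y) (fun x => eD.symm_apply_apply x)
  -- the square: `α_I ∘ res_{D→I} = res_{P→I} ∘ α_D`
  have hsq : ∀ z : discreteH1 (decompIn H v) A,
      αI (resH1Hom (subgroupInclusion (inertiaIn_le_decompIn H v)) (AddMonoidHom.id A) (fun _ _ ↦ rfl) z) =
        resLe ρ.toTopRep hIP 1 (αD z) := by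
    intro z
    obtain ⟨f, rfl⟩ := oneCocycleClass_surjective _ z
    have e1 : resH1Hom (subgroupInclusion (inertiaIn_le_decompIn H v)) (AddMonoidHom.id A) (fun _ _ ↦ rfl)
        (oneCocycleClass _ f) = oneCocycleClass _ (contOneCocycles.pullback
          (subgroupInclusion (inertiaIn_le_decompIn H v))
          (resHomOfEquivariant (subgroupInclusion (inertiaIn_le_decompIn H v)) (AddMonoidHom.id A) (fun _ _ ↦ rfl)) f) :=
      map_oneCocycleClass _ _ _ f
    rw [e1]
    simp only [αI, αD]
    rw [map_oneCocycleClass, map_oneCocycleClass]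
    refine Eq.trans ?_ (resLe_oneCocycleClass ρ.toTopRep hIP _).symm
    exact congrArg _ (Subtype.ext (ContinuousMap.ext fun _ => rfl))
  -- the abstract structure theorem on `Γ_F`
  have htor : ∀ m : A, ∃ k : ℕ, p ^ k • m = 0 := fun m => by
    obtain ⟨k, hk⟩ := (AddCommGroup.mem_primaryComponent).1 m.2
    exact ⟨k, Subtype.ext (by rw [AddSubmonoidClass.coe_nsmul, ZeroMemClass.coe_zero]; exact hk)⟩
  have hfin : ∀ k : ℕ, Set.Finite {m : A | p ^ k • m = 0} := fun k => by
    haveI := W.finite_torsionBy_geomPrimaryTorsion p k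
    have e : {m : A | p ^ k • m = 0} =
        ((AddSubgroup.torsionBy A (p ^ k : ℕ) : AddSubgroup A) : Set A) := by
      ext m
      rw [Set.mem_setOf_eq, SetLike.mem_coe, AddSubgroup.torsionBy.nsmul_iff]
    rw [e]
    exact Set.toFinite _
  have hfree : FundamentalExtension.IsFreeProcyclic (absoluteGaloisGroup F ⧸ absInertia F) :=
    isFreeProcyclic_quotient_absInertia' F
  have hdense : Dense (zpowers (QuotientGroup.mk φ : absoluteGaloisGroup F ⧸ absInertia F) :
      Set (absoluteGaloisGroup F ⧸ absInertia F)) := dense_zpowers_mk_absInertia_of_isFrobPow F hφ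
  -- `κ(res φ) ≠ 1`: otherwise `κ_F` kills the dense set `I_F · ⟨φ⟩`, hence `Γ_F`, so `D_v ≤ H`
  have hκφ : κF φ ≠ 1 := by
    intro h1
    apply not_decomp_le_kerSubgroup_of_isCyclotomic κ v hκ hpv
    rintro _ ⟨σ, rfl⟩
    rw [ZpExtension.mem_kerSubgroup]
    change κF σ = 1
    -- `κ_F = 1` on the dense set `N · ⟨φ⟩`, hence everywhere
    have hcl : IsClosed {g : absoluteGaloisGroup F | κF g = 1} := (isClosed_singleton).preimage κF.continuous_toFun
    have hsub : ((absInertia F : Set (absoluteGaloisGroup F)) * (zpowers φ : Set (absoluteGaloisGroup F))) ⊆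
        {g : absoluteGaloisGroup F | κF g = 1} := by
      rintro _ ⟨i, hi, _, ⟨k, rfl⟩, rfl⟩
      change κF (i * φ ^ k) = 1
      rw [map_mul, map_zpow, hκFI i hi, h1, one_zpow, mul_one]
    have hd := dense_mul_zpowers_of_dense (absInertia F) φ hdense
    have : {g : absoluteGaloisGroup F | κF g = 1} = Set.univ :=
      Set.eq_univ_of_univ_subset ((hd.closure_eq ▸ closure_minimal hsub hcl : _))
    exact (Set.eq_univ_iff_forall.1 this) σ
  have habs := exists_resLe_ker_eq_iff_exists_conjMap_pow_eq ρ htor hfin (absInertia F) (isClosed_absInertia_holds F)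
    hfree φ hdense κF hκFI hκφ hIP
  -- assemble
  refine ⟨αI.hom.toLinearMap.toAddMonoidHom, ⟨hαIinj, hαIsurj⟩, fun y => ?_⟩
  change y ∈ _ ↔ ∃ n : ℕ, conjMap ρ.toTopRep (absInertia F) (φ ^ p ^ n) 1 (αI y) = αI y
  rw [← habs (αI y)]
  constructor
  · rintro ⟨z, rfl⟩
    exact ⟨αD z, (hsq z).symm⟩
  · rintro ⟨zc, hzc⟩
    obtain ⟨z, rfl⟩ := hαDsurj zc
    refine ⟨z, hαIinj ?_⟩
    rw [hsq z, hzc]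

end NumberField

end Summit.BirchSwinnertonDyer.BirchSwinnertonDyer.Theorems.SignedTransportAtTwo

end
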